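import Summits.MatrixMultiplication.OmegaCensus.DominoZpZpStructSevenGen
import Summits.MatrixMultiplication.OmegaCensus.DominoZpZpStructFiveCheck
import HarnessLib

/-!
# Structural cover argument for part size `7`: the finite PAIR CHECKS and their soundness

ω-census `pub-omega`, family (b3), seat pub-omega-group gen 24.  Framing: lottery ticket; floor = certified bounds/negative
ranges.  VALUE: reduces the pair properties `h3a` (`x₀ = x₁ = x₂` against `y₀ = y₃`) and `h3b` (`x₀ = x₁`, `x₂ = x₃` against
`y₀ = y₂`) of `DominoZpZpStructSevenCore.exists_goodS7` to Bool programs, with three changes w.r.t. the part-`6` file that make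
septuples affordable in the kernel (measured on the farm, `p = 11`: ≈ 7 ms per configuration instead of ≈ 22 ms):
* the count-vector code of a collapse is computed STRAIGHT-LINE as `Σ_k 8^(p−1−m_k)` on unpacked values (`pcode7`; equals
  `polyBE 8 (key7 m)`, `polyBE_key7`), no intermediate count vector / `getD` walks;
* the `y`-arrangements are generated in the kernel from the representatives (`arr7Y2/arr7Y3` of `DominoZpZpStructSevenGen.lean`,
  completeness a theorem) — no literal lists;
* the `x`-arrangements are NORMALISED (`arr7TN`: entries `4,5,6` sorted; `arr7PN`: additionally `x₀ ≤ x₂`), justified here by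
  relabelling (`exists_sort456`, the block swap `(0 2)(1 3)`), which divides the part-`7` families by `6` resp. `12`.
NOT progress on ω.
-/

namespace Summit.MatrixMultiplication.OmegaCensus

open Finset

namespace ZpZpDomino

/-! ## Programs -/

section Program

/-- The twenty-one index pairs `i < j` of `Fin 7`. [folklore] -/
def pairs21 : List (ℕ × ℕ) :=
  [(0,1), (0,2), (0,3), (0,4), (0,5), (0,6), (1,2), (1,3), (1,4), (1,5), (1,6), (2,3), (2,4), (2,5), (2,6), (3,4), (3,5), (3,6),
    (4,5), (4,6), (5,6)]
/-- The pairs are valid distinct indices. [folklore] -/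
theorem pairs21_spec : ∀ ij ∈ pairs21, ij.1 < 7 ∧ ij.2 < 7 ∧ ij.1 ≠ ij.2 := by decide

/-- Select one of seven values. [folklore] -/
def sel7 (i x0 x1 x2 x3 x4 x5 x6 : ℕ) : ℕ :=
  match i with
  | 0 => x0 | 1 => x1 | 2 => x2 | 3 => x3 | 4 => x4 | 5 => x5 | _ => x6

/-- Straight-line code `Σ_k 8^(p−1−m_k)` of the collapse `m_k = ((y_i − y_j) x_k − (x_i − x_j) y_k) mod p` of the pair with values
`(xi, yi)`, `(xj, yj)`. [folklore] -/
def pcode7 (p x0 x1 x2 x3 x4 x5 x6 y0 y1 y2 y3 y4 y5 y6 xi xj yi yj : ℕ) : ℕ :=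
  let a := yi + (p - yj)
  let b := xj + (p - xi)
  8 ^ (p - 1 - (a * x0 + b * y0) % p) + 8 ^ (p - 1 - (a * x1 + b * y1) % p) + 8 ^ (p - 1 - (a * x2 + b * y2) % p) +
    8 ^ (p - 1 - (a * x3 + b * y3) % p) + 8 ^ (p - 1 - (a * x4 + b * y4) % p) + 8 ^ (p - 1 - (a * x5 + b * y5) % p) +
    8 ^ (p - 1 - (a * x6 + b * y6) % p)

/-- Some index pair separates the points and collapses to a septuple whose code is not in the tree `et`. [folklore] -/
def pairGood7 (p : ℕ) (et : BTree) (xs ys : List ℕ) : Bool :=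
  match xs, ys with
  | [x0, x1, x2, x3, x4, x5, x6], [y0, y1, y2, y3, y4, y5, y6] =>
    pairs21.any fun ij =>
      (!(sel7 ij.1 x0 x1 x2 x3 x4 x5 x6 == sel7 ij.2 x0 x1 x2 x3 x4 x5 x6) ||
          !(sel7 ij.1 y0 y1 y2 y3 y4 y5 y6 == sel7 ij.2 y0 y1 y2 y3 y4 y5 y6)) &&
        !(et.mem (pcode7 p x0 x1 x2 x3 x4 x5 x6 y0 y1 y2 y3 y4 y5 y6 (sel7 ij.1 x0 x1 x2 x3 x4 x5 x6)
          (sel7 ij.2 x0 x1 x2 x3 x4 x5 x6) (sel7 ij.1 y0 y1 y2 y3 y4 y5 y6) (sel7 ij.2 y0 y1 y2 y3 y4 y5 y6)))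
  | _, _ => false

/-- The pair check of ONE `x`-arrangement against the `y₀ = y₃` arrangements of the representatives `R` (family `a`). [folklore] -/
def checkH7ax (p : ℕ) (et : BTree) (R : List (List ℕ)) (xs : List ℕ) : Bool :=
  R.all fun k₂ => (arr7Y3 p k₂).all fun ys => pairGood7 p et xs ys
/-- The pair check of ONE `x`-arrangement against the `y₀ = y₂` arrangements of the representatives `R` (family `b`). [folklore] -/
def checkH7bx (p : ℕ) (et : BTree) (R : List (List ℕ)) (xs : List ℕ) : Bool :=
  R.all fun k₂ => (arr7Y2 p k₂).all fun ys => pairGood7 p et xs ys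

/-- BATCHED family-`a` check: the `y`-arrangements of `R` are generated once and tested against every `x`-arrangement
of `XS` (the kernel form used by the per-prime files; `checkH7ax_of_xs`). [folklore] -/
def checkH7axs (p : ℕ) (et : BTree) (R XS : List (List ℕ)) : Bool :=
  R.all fun k₂ => (arr7Y3 p k₂).all fun ys => XS.all fun xs => pairGood7 p et xs ys
/-- BATCHED family-`b` check. [folklore] -/
def checkH7bxs (p : ℕ) (et : BTree) (R XS : List (List ℕ)) : Bool :=
  R.all fun k₂ => (arr7Y2 p k₂).all fun ys => XS.all fun xs => pairGood7 p et xs ys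

/-- Family `a` for one representative `k₁`: all normalised `x`-arrangements. [folklore] -/
def checkH7a (p : ℕ) (et : BTree) (R : List (List ℕ)) (k₁ : List ℕ) : Bool :=
  (arr7TN p k₁).all fun xs => checkH7ax p et R xs
/-- Family `b` for one representative `k₁`. [folklore] -/
def checkH7b (p : ℕ) (et : BTree) (R : List (List ℕ)) (k₁ : List ℕ) : Bool :=
  (arr7PN p k₁).all fun xs => checkH7bx p et R xs

/-- Every excluded key scales into the list of representatives (part `7` copy of `checkR`). [folklore] -/
def checkR7 (p : ℕ) (E R : List (List ℕ)) : Bool :=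
  E.all fun k => (List.range p).any fun κ => !(κ == 0) && R.contains (scaleVec p κ k)

/-- Family `a` from its `x`-arrangements. [folklore] -/
theorem checkH7a_of_x {p : ℕ} {et : BTree} {R : List (List ℕ)} {k : List ℕ}
    (h : ∀ xs ∈ arr7TN p k, checkH7ax p et R xs = true) : checkH7a p et R k = true := by
  rw [checkH7a, List.all_eq_true]; exact h
/-- Family `b` from its `x`-arrangements. [folklore] -/
theorem checkH7b_of_x {p : ℕ} {et : BTree} {R : List (List ℕ)} {k : List ℕ}
    (h : ∀ xs ∈ arr7PN p k, checkH7bx p et R xs = true) : checkH7b p et R k = true := by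
  rw [checkH7b, List.all_eq_true]; exact h

/-- One `x`-arrangement out of a batched check (family `a`). [folklore] -/
theorem checkH7ax_of_xs {p : ℕ} {et : BTree} {R XS : List (List ℕ)} {xs : List ℕ} (h : checkH7axs p et R XS = true)
    (hx : xs ∈ XS) : checkH7ax p et R xs = true := by
  simp only [checkH7axs, checkH7ax, List.all_eq_true] at h ⊢
  exact fun k hk ys hys => h k hk ys hys xs hx
/-- One `x`-arrangement out of a batched check (family `b`). [folklore] -/
theorem checkH7bx_of_xs {p : ℕ} {et : BTree} {R XS : List (List ℕ)} {xs : List ℕ} (h : checkH7bxs p et R XS = true)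
    (hx : xs ∈ XS) : checkH7bx p et R xs = true := by
  simp only [checkH7bxs, checkH7bx, List.all_eq_true] at h ⊢
  exact fun k hk ys hys => h k hk ys hys xs hx

/-- Splitting the representatives of an `x`-check (family `a`). [folklore] -/
theorem checkH7ax_append {p : ℕ} {et : BTree} {R₁ R₂ : List (List ℕ)} {xs : List ℕ}
    (h₁ : checkH7ax p et R₁ xs = true) (h₂ : checkH7ax p et R₂ xs = true) : checkH7ax p et (R₁ ++ R₂) xs = true := by
  rw [checkH7ax, List.all_append, Bool.and_eq_true]; exact ⟨h₁, h₂⟩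
/-- Splitting the representatives of an `x`-check (family `b`). [folklore] -/
theorem checkH7bx_append {p : ℕ} {et : BTree} {R₁ R₂ : List (List ℕ)} {xs : List ℕ}
    (h₁ : checkH7bx p et R₁ xs = true) (h₂ : checkH7bx p et R₂ xs = true) : checkH7bx p et (R₁ ++ R₂) xs = true := by
  rw [checkH7bx, List.all_append, Bool.and_eq_true]; exact ⟨h₁, h₂⟩

end Program

/-! ## Soundness -/

section Sound

variable {p : ℕ} [Fact p.Prime]

omit [Fact p.Prime] in
/-- `sel7` on the values of a septuple. [folklore] -/
theorem sel7_vals (x : Fin 7 → ZMod p) (i : Fin 7) :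
    sel7 i.val (x 0).val (x 1).val (x 2).val (x 3).val (x 4).val (x 5).val (x 6).val = (x i).val := by
  fin_cases i <;> rfl

/-- The straight-line collapse value is the `ZMod p` value. [folklore] -/
theorem collapse_val (x y : Fin 7 → ZMod p) (i j k : Fin 7) :
    (((y i).val + (p - (y j).val)) * (x k).val + ((x j).val + (p - (x i).val)) * (y k).val) % p =
      ((y i - y j) * x k - (x i - x j) * y k).val := by
  have h : (((((y i).val + (p - (y j).val)) * (x k).val + ((x j).val + (p - (x i).val)) * (y k).val) % p : ℕ) : ZMod p) =
      (y i - y j) * x k - (x i - x j) * y k := by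
    rw [ZMod.natCast_mod]
    push_cast
    rw [Nat.cast_sub (ZMod.val_le _), Nat.cast_sub (ZMod.val_le _)]
    simp only [ZMod.natCast_val, ZMod.cast_id', id_eq, ZMod.natCast_self]
    ring
  have := congrArg ZMod.val h
  rwa [ZMod.val_natCast, Nat.mod_eq_of_lt (Nat.mod_lt _ (Fact.out : p.Prime).pos)] at this

/-- `polyBE` of a key is the sum of the digit weights of the values. [folklore] -/
theorem polyBE_key7 (B : ℕ) (a : Fin 7 → ZMod p) : polyBE B (key7 a) = ∑ k : Fin 7, B ^ (p - 1 - (a k).val) := by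
  haveI : NeZero p := ⟨(Fact.out : p.Prime).ne_zero⟩
  have e : key7 a = List.ofFn fun v : Fin p => cnt7 (a 0).val (a 1).val (a 2).val (a 3).val (a 4).val (a 5).val (a 6).val v.val := by
    rw [key7, cv7, List.ofFn_eq_map, ← List.map_coe_finRange_eq_range, List.map_map]; rfl
  rw [e, polyBE_ofFn]
  simp only [cnt7_key7_eq_sum, Finset.sum_mul]
  rw [Finset.sum_comm]
  refine Finset.sum_congr rfl fun k _ => ?_
  rw [Finset.sum_eq_single ⟨(a k).val, ZMod.val_lt _⟩]
  · simp
  · intro v _ hv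
    rw [if_neg (fun h => hv (Fin.ext h.symm)), zero_mul]
  · intro h; exact absurd (mem_univ _) h

/-- `pcode7` on the values of `x, y` at the pair `(i, j)` is the code of the key of the collapsing septuple. [folklore] -/
theorem pcode7_eq (x y : Fin 7 → ZMod p) (i j : Fin 7) :
    pcode7 p (x 0).val (x 1).val (x 2).val (x 3).val (x 4).val (x 5).val (x 6).val (y 0).val (y 1).val (y 2).val (y 3).val
      (y 4).val (y 5).val (y 6).val (x i).val (x j).val (y i).val (y j).val =
      polyBE 8 (key7 fun k => (y i - y j) * x k - (x i - x j) * y k) := by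
  rw [polyBE_key7, Fin.sum_univ_seven, pcode7]
  simp only [collapse_val]

/-- **Soundness of `pairGood7`**: with a COMPLETE code tree of `E` (`hEt`), a good pair has distinct points and a key outside `E`.
[folklore] -/
theorem exists_pair_of_pairGood7 {E : List (List ℕ)} {et : BTree} (hEt : ∀ k ∈ E, et.mem (polyBE 8 k) = true)
    (x y : Fin 7 → ZMod p) (h : pairGood7 p et (vals7 x) (vals7 y) = true) :
    ∃ i j : Fin 7, (x i, y i) ≠ (x j, y j) ∧ key7 (fun k => (y i - y j) * x k - (x i - x j) * y k) ∉ E := by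
  rw [vals7, vals7, pairGood7, List.any_eq_true] at h
  obtain ⟨ij, hij, hgood⟩ := h
  obtain ⟨hi, hj, -⟩ := pairs21_spec ij hij
  rw [Bool.and_eq_true] at hgood
  obtain ⟨hsep, hnot⟩ := hgood
  have s1 := sel7_vals x ⟨ij.1, hi⟩
  have s2 := sel7_vals x ⟨ij.2, hj⟩
  have s3 := sel7_vals y ⟨ij.1, hi⟩
  have s4 := sel7_vals y ⟨ij.2, hj⟩
  simp only at s1 s2 s3 s4
  rw [s1, s2, s3, s4] at hsep hnot
  refine ⟨⟨ij.1, hi⟩, ⟨ij.2, hj⟩, fun e => ?_, fun hmem => ?_⟩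
  · rw [Bool.or_eq_true, Bool.not_eq_true', Bool.not_eq_true', beq_eq_false_iff_ne, beq_eq_false_iff_ne] at hsep
    have e1 := congrArg Prod.fst e
    have e2 := congrArg Prod.snd e
    simp only at e1 e2
    rcases hsep with h1 | h1
    · exact h1 (by rw [e1])
    · exact h1 (by rw [e2])
  · rw [Bool.not_eq_true', pcode7_eq] at hnot
    have := hEt _ hmem
    rw [this] at hnot
    exact Bool.noConfusion hnot

/-! ### Relabelling (normalisation of the `x`-arrangement) -/

/-- Transport of the pair conclusion along a relabelling `σ` of the indices. [folklore] -/
theorem pairConcl_of_perm {E : List (List ℕ)} (x y : Fin 7 → ZMod p) (σ : Equiv.Perm (Fin 7))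
    (h : ∃ i j : Fin 7, (x (σ i), y (σ i)) ≠ (x (σ j), y (σ j)) ∧
      key7 (fun k => (y (σ i) - y (σ j)) * x (σ k) - (x (σ i) - x (σ j)) * y (σ k)) ∉ E) :
    ∃ i j : Fin 7, (x i, y i) ≠ (x j, y j) ∧ key7 (fun k => (y i - y j) * x k - (x i - x j) * y k) ∉ E := by
  obtain ⟨i, j, hne, hk⟩ := h
  refine ⟨σ i, σ j, hne, ?_⟩
  have e : key7 (fun k => (y (σ i) - y (σ j)) * x (σ k) - (x (σ i) - x (σ j)) * y (σ k)) =
      key7 (fun k => (y (σ i) - y (σ j)) * x k - (x (σ i) - x (σ j)) * y k) :=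
    key7_perm (fun k => (y (σ i) - y (σ j)) * x k - (x (σ i) - x (σ j)) * y k) σ
  rw [e] at hk
  exact hk

omit [Fact p.Prime] in
/-- **Sorting the entries `4, 5, 6`** by a relabelling fixing `0, 1, 2, 3`. [folklore] -/
theorem exists_sort456 (x : Fin 7 → ZMod p) : ∃ σ : Equiv.Perm (Fin 7), (σ 0 = 0 ∧ σ 1 = 1 ∧ σ 2 = 2 ∧ σ 3 = 3) ∧
    (x (σ 4)).val ≤ (x (σ 5)).val ∧ (x (σ 5)).val ≤ (x (σ 6)).val := by
  rcases le_total (x 4).val (x 5).val with hab | hba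
  · rcases le_total (x 5).val (x 6).val with hbc | hcb
    · exact ⟨1, by decide, hab, hbc⟩
    · rcases le_total (x 4).val (x 6).val with hac | hca
      · refine ⟨Equiv.swap 5 6, by decide, ?_, ?_⟩
        · rw [show Equiv.swap (5 : Fin 7) 6 4 = 4 from by decide, show Equiv.swap (5 : Fin 7) 6 5 = 6 from by decide]
          exact hac
        · rw [show Equiv.swap (5 : Fin 7) 6 5 = 6 from by decide, show Equiv.swap (5 : Fin 7) 6 6 = 5 from by decide]
          exact hcb
      · refine ⟨(Equiv.swap 4 5).trans (Equiv.swap 5 6), by decide, ?_, ?_⟩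
        · rw [show ((Equiv.swap (4 : Fin 7) 5).trans (Equiv.swap 5 6)) 4 = 6 from by decide,
            show ((Equiv.swap (4 : Fin 7) 5).trans (Equiv.swap 5 6)) 5 = 4 from by decide]
          exact hca
        · rw [show ((Equiv.swap (4 : Fin 7) 5).trans (Equiv.swap 5 6)) 5 = 4 from by decide,
            show ((Equiv.swap (4 : Fin 7) 5).trans (Equiv.swap 5 6)) 6 = 5 from by decide]
          exact hab
  · rcases le_total (x 4).val (x 6).val with hac | hca
    · refine ⟨Equiv.swap 4 5, by decide, ?_, ?_⟩
      · rw [show Equiv.swap (4 : Fin 7) 5 4 = 5 from by decide, show Equiv.swap (4 : Fin 7) 5 5 = 4 from by decide]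
        exact hba
      · rw [show Equiv.swap (4 : Fin 7) 5 5 = 4 from by decide, show Equiv.swap (4 : Fin 7) 5 6 = 6 from by decide]
        exact hac
    · rcases le_total (x 5).val (x 6).val with hbc | hcb
      · refine ⟨(Equiv.swap 5 6).trans (Equiv.swap 4 5), by decide, ?_, ?_⟩
        · rw [show ((Equiv.swap (5 : Fin 7) 6).trans (Equiv.swap 4 5)) 4 = 5 from by decide,
            show ((Equiv.swap (5 : Fin 7) 6).trans (Equiv.swap 4 5)) 5 = 6 from by decide]
          exact hbc
        · rw [show ((Equiv.swap (5 : Fin 7) 6).trans (Equiv.swap 4 5)) 5 = 6 from by decide,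
            show ((Equiv.swap (5 : Fin 7) 6).trans (Equiv.swap 4 5)) 6 = 4 from by decide]
          exact hca
      · refine ⟨Equiv.swap 4 6, by decide, ?_, ?_⟩
        · rw [show Equiv.swap (4 : Fin 7) 6 4 = 6 from by decide, show Equiv.swap (4 : Fin 7) 6 5 = 5 from by decide]
          exact hcb
        · rw [show Equiv.swap (4 : Fin 7) 6 5 = 5 from by decide, show Equiv.swap (4 : Fin 7) 6 6 = 4 from by decide]
          exact hba

/-- The block swap `(0 2)(1 3)`. [folklore] -/
def blockSwap : Equiv.Perm (Fin 7) := (Equiv.swap 0 2).trans (Equiv.swap 1 3)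

/-- Values of `blockSwap`. [folklore] -/
theorem blockSwap_apply : blockSwap 0 = 2 ∧ blockSwap 1 = 3 ∧ blockSwap 2 = 0 ∧ blockSwap 3 = 1 ∧ blockSwap 4 = 4 ∧
    blockSwap 5 = 5 ∧ blockSwap 6 = 6 := by decide

/-! ### Scaling into the representatives -/

omit [Fact p.Prime] in
/-- `checkR7` ⇒ every excluded key scales into `R`. [folklore] -/
theorem hR7_of_check {E R : List (List ℕ)} (h : checkR7 p E R = true) :
    ∀ k ∈ E, ∃ κ : ℕ, 1 ≤ κ ∧ κ < p ∧ scaleVec p κ k ∈ R := by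
  intro k hk
  simp only [checkR7, List.all_eq_true, List.any_eq_true, List.mem_range, Bool.and_eq_true, Bool.not_eq_true',
    beq_eq_false_iff_ne, ne_eq, List.contains_iff_mem] at h
  obtain ⟨κ, hκ, h0, hR⟩ := h k hk
  exact ⟨κ, Nat.one_le_iff_ne_zero.2 h0, hκ, hR⟩

/-- Scaling a septuple into the representatives. [folklore] -/
theorem exists_smul_mem_R7 {E R : List (List ℕ)} (hR : ∀ k ∈ E, ∃ κ : ℕ, 1 ≤ κ ∧ κ < p ∧ scaleVec p κ k ∈ R)
    (x : Fin 7 → ZMod p) (hx : key7 x ∈ E) : ∃ κ : ZMod p, κ ≠ 0 ∧ key7 (fun i => κ * x i) ∈ R := by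
  obtain ⟨κ, hκ1, hκp, hκR⟩ := hR _ hx
  have hκ : ((κ : ℕ) : ZMod p) ≠ 0 := by
    rw [Ne, ZMod.natCast_eq_zero_iff]; exact Nat.not_dvd_of_pos_of_lt hκ1 hκp
  refine ⟨κ, hκ, ?_⟩
  have := key7_smul hκ x
  rw [ZMod.val_natCast, Nat.mod_eq_of_lt hκp] at this
  rw [this]; exact hκR

/-- Unscaling the conclusion of a pair check. [folklore] -/
theorem unscale_pair7 {E : List (List ℕ)} (hE2 : ∀ k ∈ E, ∀ κ : ℕ, 1 ≤ κ → κ < p → scaleVec p κ k ∈ E)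
    (x y : Fin 7 → ZMod p) {κ μ : ZMod p} (hκ : κ ≠ 0) (hμ : μ ≠ 0) {i j : Fin 7}
    (hne : (κ * x i, μ * y i) ≠ (κ * x j, μ * y j))
    (hm : key7 (fun k => (μ * y i - μ * y j) * (κ * x k) - (κ * x i - κ * x j) * (μ * y k)) ∉ E) :
    (x i, y i) ≠ (x j, y j) ∧ key7 (fun k => (y i - y j) * x k - (x i - x j) * y k) ∉ E := by
  refine ⟨fun e => hne ?_, fun hmem => hm ?_⟩
  · have e1 := congrArg Prod.fst e
    have e2 := congrArg Prod.snd e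
    simp only at e1 e2
    rw [e1, e2]
  · have hsc : (fun k => (μ * y i - μ * y j) * (κ * x k) - (κ * x i - κ * x j) * (μ * y k)) =
        fun k => (κ * μ) * ((y i - y j) * x k - (x i - x j) * y k) := by funext k; ring
    rw [hsc]
    exact key7_smul_mem hE2 (mul_ne_zero hκ hμ) _ hmem

/-! ### Soundness of the two family checks -/

/-- Family `a` on NORMALISED data: keys in `R`, entries `4, 5, 6` sorted. [folklore] -/
theorem h3a_core {E R : List (List ℕ)} {et : BTree} (hEt : ∀ k ∈ E, et.mem (polyBE 8 k) = true)
    (hchk : ∀ k ∈ R, checkH7a p et R k = true) (x y : Fin 7 → ZMod p) (h01 : x 0 = x 1) (h12 : x 1 = x 2)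
    (h45 : (x 4).val ≤ (x 5).val) (h56 : (x 5).val ≤ (x 6).val) (hxR : key7 x ∈ R) (h03 : y 0 = y 3)
    (hyR : key7 y ∈ R) :
    ∃ i j : Fin 7, (x i, y i) ≠ (x j, y j) ∧ key7 (fun k => (y i - y j) * x k - (x i - x j) * y k) ∉ E := by
  have h1 := hchk _ hxR
  rw [checkH7a, List.all_eq_true] at h1
  have h2 := h1 _ (vals_mem_arr7TN x h01 h12 h45 h56)
  rw [checkH7ax, List.all_eq_true] at h2
  have h3 := h2 _ hyR
  rw [List.all_eq_true] at h3
  exact exists_pair_of_pairGood7 hEt x y (h3 _ (vals_mem_arr7Y3 y h03))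

/-- Family `b` on NORMALISED data: keys in `R`, `x₀ ≤ x₂`, entries `4, 5, 6` sorted. [folklore] -/
theorem h3b_core {E R : List (List ℕ)} {et : BTree} (hEt : ∀ k ∈ E, et.mem (polyBE 8 k) = true)
    (hchk : ∀ k ∈ R, checkH7b p et R k = true) (x y : Fin 7 → ZMod p) (h01 : x 0 = x 1) (h23 : x 2 = x 3)
    (h02 : (x 0).val ≤ (x 2).val) (h45 : (x 4).val ≤ (x 5).val) (h56 : (x 5).val ≤ (x 6).val) (hxR : key7 x ∈ R)
    (hy02 : y 0 = y 2) (hyR : key7 y ∈ R) :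
    ∃ i j : Fin 7, (x i, y i) ≠ (x j, y j) ∧ key7 (fun k => (y i - y j) * x k - (x i - x j) * y k) ∉ E := by
  have h1 := hchk _ hxR
  rw [checkH7b, List.all_eq_true] at h1
  have h2 := h1 _ (vals_mem_arr7PN x h01 h23 h02 h45 h56)
  rw [checkH7bx, List.all_eq_true] at h2
  have h3 := h2 _ hyR
  rw [List.all_eq_true] at h3
  exact exists_pair_of_pairGood7 hEt x y (h3 _ (vals_mem_arr7Y2 y hy02))

/-- **Soundness of the family-`a` check** (hypothesis `h3a` of `exists_goodS7`): scale into `R`, sort the entries `4, 5, 6`,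
apply `h3a_core`, relabel and unscale back. [folklore] -/
theorem h3a_of_checkH7a {E R : List (List ℕ)} {et : BTree}
    (hE2 : ∀ k ∈ E, ∀ κ : ℕ, 1 ≤ κ → κ < p → scaleVec p κ k ∈ E)
    (hR : ∀ k ∈ E, ∃ κ : ℕ, 1 ≤ κ ∧ κ < p ∧ scaleVec p κ k ∈ R) (hEt : ∀ k ∈ E, et.mem (polyBE 8 k) = true)
    (hchk : ∀ k ∈ R, checkH7a p et R k = true)
    (x y : Fin 7 → ZMod p) (h01 : x 0 = x 1) (h12 : x 1 = x 2) (hxE : key7 x ∈ E) (h03 : y 0 = y 3)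
    (hyE : key7 y ∈ E) :
    ∃ i j : Fin 7, (x i, y i) ≠ (x j, y j) ∧ key7 (fun k => (y i - y j) * x k - (x i - x j) * y k) ∉ E := by
  obtain ⟨κ, hκ, hxR⟩ := exists_smul_mem_R7 hR x hxE
  obtain ⟨μ, hμ, hyR⟩ := exists_smul_mem_R7 hR y hyE
  set x₁ : Fin 7 → ZMod p := fun i => κ * x i with hx₁
  set y₁ : Fin 7 → ZMod p := fun i => μ * y i with hy₁
  suffices h₁ : ∃ i j : Fin 7, (x₁ i, y₁ i) ≠ (x₁ j, y₁ j) ∧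
      key7 (fun k => (y₁ i - y₁ j) * x₁ k - (x₁ i - x₁ j) * y₁ k) ∉ E by
    obtain ⟨i, j, hne, hm⟩ := h₁
    exact ⟨i, j, unscale_pair7 hE2 x y hκ hμ hne hm⟩
  obtain ⟨σ, ⟨hσ0, hσ1, hσ2, hσ3⟩, h45, h56⟩ := exists_sort456 x₁
  apply pairConcl_of_perm x₁ y₁ σ
  have hxR' : key7 (fun i => x₁ (σ i)) ∈ R := by rw [key7_perm x₁ σ]; exact hxR
  have hyR' : key7 (fun i => y₁ (σ i)) ∈ R := by rw [key7_perm y₁ σ]; exact hyR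
  exact h3a_core hEt hchk (fun i => x₁ (σ i)) (fun i => y₁ (σ i)) (by simp only [hσ0, hσ1, hx₁, h01])
    (by simp only [hσ1, hσ2, hx₁, h12]) h45 h56 hxR' (by simp only [hσ0, hσ3, hy₁, h03]) hyR'

/-- **Soundness of the family-`b` check** (hypothesis `h3b` of `exists_goodS7`): scale, sort the entries `4, 5, 6`, swap the two
blocks if `x₂ < x₀`, apply `h3b_core`, relabel and unscale back. [folklore] -/
theorem h3b_of_checkH7b {E R : List (List ℕ)} {et : BTree}
    (hE2 : ∀ k ∈ E, ∀ κ : ℕ, 1 ≤ κ → κ < p → scaleVec p κ k ∈ E)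
    (hR : ∀ k ∈ E, ∃ κ : ℕ, 1 ≤ κ ∧ κ < p ∧ scaleVec p κ k ∈ R) (hEt : ∀ k ∈ E, et.mem (polyBE 8 k) = true)
    (hchk : ∀ k ∈ R, checkH7b p et R k = true)
    (x y : Fin 7 → ZMod p) (h01 : x 0 = x 1) (h23 : x 2 = x 3) (hxE : key7 x ∈ E) (h02 : y 0 = y 2)
    (hyE : key7 y ∈ E) :
    ∃ i j : Fin 7, (x i, y i) ≠ (x j, y j) ∧ key7 (fun k => (y i - y j) * x k - (x i - x j) * y k) ∉ E := by
  obtain ⟨κ, hκ, hxR⟩ := exists_smul_mem_R7 hR x hxE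
  obtain ⟨μ, hμ, hyR⟩ := exists_smul_mem_R7 hR y hyE
  set x₁ : Fin 7 → ZMod p := fun i => κ * x i with hx₁
  set y₁ : Fin 7 → ZMod p := fun i => μ * y i with hy₁
  suffices h₁ : ∃ i j : Fin 7, (x₁ i, y₁ i) ≠ (x₁ j, y₁ j) ∧
      key7 (fun k => (y₁ i - y₁ j) * x₁ k - (x₁ i - x₁ j) * y₁ k) ∉ E by
    obtain ⟨i, j, hne, hm⟩ := h₁
    exact ⟨i, j, unscale_pair7 hE2 x y hκ hμ hne hm⟩
  obtain ⟨σ, ⟨hσ0, hσ1, hσ2, hσ3⟩, h45, h56⟩ := exists_sort456 x₁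
  apply pairConcl_of_perm x₁ y₁ σ
  set x₂ : Fin 7 → ZMod p := fun i => x₁ (σ i) with hx₂
  set y₂ : Fin 7 → ZMod p := fun i => y₁ (σ i) with hy₂
  have hxR' : key7 x₂ ∈ R := by rw [hx₂, key7_perm x₁ σ]; exact hxR
  have hyR' : key7 y₂ ∈ R := by rw [hy₂, key7_perm y₁ σ]; exact hyR
  have e01 : x₂ 0 = x₂ 1 := by simp only [hx₂, hσ0, hσ1, hx₁, h01]
  have e23 : x₂ 2 = x₂ 3 := by simp only [hx₂, hσ2, hσ3, hx₁, h23]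
  have f02 : y₂ 0 = y₂ 2 := by simp only [hy₂, hσ0, hσ2, hy₁, h02]
  show ∃ i j : Fin 7, (x₂ i, y₂ i) ≠ (x₂ j, y₂ j) ∧ key7 (fun k => (y₂ i - y₂ j) * x₂ k - (x₂ i - x₂ j) * y₂ k) ∉ E
  by_cases hle : (x₂ 0).val ≤ (x₂ 2).val
  · exact h3b_core hEt hchk x₂ y₂ e01 e23 hle h45 h56 hxR' f02 hyR'
  · obtain ⟨t0, t1, t2, t3, t4, t5, t6⟩ := blockSwap_apply
    apply pairConcl_of_perm x₂ y₂ blockSwap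
    have hxR'' : key7 (fun i => x₂ (blockSwap i)) ∈ R := by rw [key7_perm x₂ blockSwap]; exact hxR'
    have hyR'' : key7 (fun i => y₂ (blockSwap i)) ∈ R := by rw [key7_perm y₂ blockSwap]; exact hyR'
    refine h3b_core hEt hchk (fun i => x₂ (blockSwap i)) (fun i => y₂ (blockSwap i)) ?_ ?_ ?_ ?_ ?_ hxR'' ?_ hyR''
    · simp only [t0, t1, e23]
    · simp only [t2, t3, e01]
    · simp only [t0, t2]; omega
    · simp only [t4, t5]; exact h45
    · simp only [t5, t6]; exact h56
    · simp only [t0, t2, f02]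

end Sound

end ZpZpDomino

end Summit.MatrixMultiplication.OmegaCensus
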